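import Summits.QuantumFields.YangMills.Theorems.FluctuationComparisonRegPrIntLS2BetaLaplaceKnit
import Literature.Analysis.Asymptotics.LaplaceMethodOrbitOpenAmplitude
import HarnessLib

/-!
# S2β · LAPLACE stub — letter LIMIT (a DOOR): the per-corner scaled Laplace limit of `heightDensityCan(γ∕λ)·e^{λβ_K m}` at a window
# datum from a compact orbit-Laplace MODEL of the fibre integral (CHART∞ ∧ RG-K rows), a GROWTH FUNCTION (GAP♯) and the minimiser (EXW)

Cell `ym3-torus` (rung R3: continuum `SU(2)` Yang–Mills on `T³` — NOT `d = 4`, NOT infinite volume, NOT a mass gap, NOT Clay); width seat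
`ym-ust-20520-w4` g15; helper of the crux `stmt-QuantumFields-20520` `UnitScaleTilt.FluctuationComparisonRegPrIntL` (`--supports`, NOT a proof of it).
LAPLACE row of LINE g18-1 `Cruxes/FluctuationComparisonRegPrIntL/Lines/semiclassical_s2beta.lean`, decomposition of record (LINE OWNER WORD 7):
(T) = CHART∞ ∘ LIMIT ∘ KNIT ∘ DECAY; KNIT = ✓`…S2BetaLaplaceKnit.tendsto_fourPt_fluct_of_laplaceLimits`; LIMIT-LIB = ✓`Literature.Analysis.Asymptotics.
tendsto_laplaceMethod_orbit_openSet_of_growth`.  THIS FILE produces the KNIT's per-corner hypotheses `hU` ∕ `hCU` at ONE window datum `V` from DISPLAYED ROWS: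
* MODEL (pens CHART∞ ⊕ RG-K): compact second-countable Hausdorff `X`, finite Borel `μ`, continuous phase `A` (Wilson action along the fibre), continuous
  amplitude `a` (chart density), open event `O` (`histGood` on the fibre) with `hmodel : heightDensityCan F (γ∕λ) hJK S V · e^{λβ_K m} =
  ∫_X e^{−(λβ_K)(A − m)} 1_O a ∂μ` (✓F3 `heightDensityCan_eq_fibreInt` ∘ ✓KNIT `heightDensityCan_mul_exp_eq_integral`); a compact first-countable group `Kg`
  (the residual gauge group) with Haar `ν` acting continuously, `μ`-preservingly, leaving `A, a, O` invariant; transversal `σ`, group chart `e`, tube `Θ`, local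
  product chart `Θ'` with window `W`, continuous density `J`, chart identity `hchart`, radius `ρ`, slice `hstab ∕ hfix` — ALL in the letters of
  ★★★`tendsto_laplaceMethod_orbit_indicator_of_continuous`;
* EXW: `σ 0 ∈ O`, `A (σ 0) = m`;  GAP♯: continuous `g ≥ 0`, positive off the orbit `Kg • σ 0`, `A ≥ m + g` on `O`; Hessian `Ah` (`hAs hpos hS2`);
* POSITIVITY: `0 < a (σ 0)`, `0 < ∫_{ball ρ} J(z,0) dκ`.
§1 `orbitConst_pos`; §2 ★★`laplaceLimit_corner` — `Tendsto (λ ↦ λ^{dim∕2}·(heightDensityCan F (γ∕λ) hJK S V · e^{λβ_K m})) atTop (𝓝 (ℓ ∕ β_K^{dim∕2}))`,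
`ℓ = (2π)^{dim∕2}·ν(Kg)·((∫_{ball ρ}J(z,0)dκ) ∕ ν(((e ball ρ)·Sst)⁻¹))·a(σ 0) ∕ √det Ah` (= KNIT's `hU`), ★`laplaceLimit_corner_pos` (= `hCU`); the exponent
`dim∕2` is the same at every corner as soon as the transversal dimension is (free action).  §3 `inner_pos_of_quadratic_growth` — GAP♯ along the transversal + the
Peano row ⇒ `hpos`; `inner_ge_of_quadratic_growth` — the quantitative edition `2c‖y‖² ≤ ⟪Ah y, y⟫` (uniform coercivity for DECAY).  The SUBTYPE EDITION (data continuous only on CHART∞'s compact guarded set `Xc ⊆ SU(2)^{bonds}`) is the sequel file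
`…S2BetaLaplaceLimitOn.lean` (★★`laplaceLimit_corner_on` ∕ `laplaceLimit_corner_on'`).

HONEST SCOPE.  A door: the MODEL ∕ EXW ∕ GAP♯ ∕ POSITIVITY rows are hypotheses, supplied by the pens CHART∞ (w3-20520), (C3) (px21), RG-K (px11), LIMIT-INST (w5)
and the organs EXW ∕ GAP♯ of the line; DECAY, LAPLACE, H4ᶜ, LFR♯ᶜ, S2β and the crux 20520 are NOT proved here; `YM3TorusSU2` NOT proved; the Yang–Mills mass gap
(Clay) NOT proved.  Def-free; no `instance` ∕ `notation`; default heartbeats.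
References: [Balaban1985UV3] CMP 102 (1985) (2) p. 256, (41) p. 266; [Balaban1985Variational] CMP 102 (1985) Thm 1 (8)–(10) p. 279, (142) p. 299;
[HasenpflugRudolfSprungk2024] Ann. Appl. Probab. 34 (2024) §3.1, §3.4, App. 4.1 Thm 16; [Hwang1980] Ann. Probab. 8 (1980); [Breitung1994] LNM 1592 Thm 41.
-/

noncomputable section

open MeasureTheory MeasureTheory.Measure Filter Topology Set Module Metric
open scoped Real InnerProductSpace ENNReal NNReal Pointwise
open Literature.MathematicalPhysics.QuantumFieldTheory.Balaban1983to89
open Literature.MathematicalPhysics.QuantumFieldTheory.Balaban1983to89.T3ContinuumYM3Torus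
open Literature.MathematicalPhysics.QuantumFieldTheory.Balaban1983to89.T3UnitLawDensityEML
open Literature.MathematicalPhysics.QuantumFieldTheory.Balaban1983to89.T3UnitScaleTilt
open Literature.MathematicalPhysics.QuantumFieldTheory.Balaban1983to89.T3TiltDescent
open Literature.MathematicalPhysics.QuantumFieldTheory.Balaban1983to89.T4Continuum
open Summit.QuantumFields.YangMills.Theorems.FluctuationComparisonRegPrIntLWregGlue
open Summit.QuantumFields.YangMills.Theorems.FluctuationComparisonRegPrIntLS2BetaLaplaceKnit
open Literature.Analysis.Asymptotics

namespace Summit.QuantumFields.YangMills.Theorems.FluctuationComparisonRegPrIntLS2BetaLaplaceLimit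

section Corner

/-! ## §1 Positivity of the orbit constant -/
variable {Vt : Type*} [NormedAddCommGroup Vt] [InnerProductSpace ℝ Vt] [FiniteDimensional ℝ Vt]
  [MeasurableSpace Vt] [BorelSpace Vt]
variable {Z : Type*} [NormedAddCommGroup Z] [NormedSpace ℝ Z] [FiniteDimensional ℝ Z]
  [MeasurableSpace Z] [BorelSpace Z]
variable {Kg : Type*} [Group Kg] [TopologicalSpace Kg] [IsTopologicalGroup Kg] [CompactSpace Kg]
  [FirstCountableTopology Kg] [MeasurableSpace Kg] [BorelSpace Kg]
variable {X : Type*} [TopologicalSpace X] [CompactSpace X] [T2Space X] [SecondCountableTopology X]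
  [MeasurableSpace X] [BorelSpace X]
variable {act : Kg → X → X} {σ : Vt → X} {e : Z → Kg} {Θ : Kg × Vt → X} {Θ' : Z × Vt → X} {Sst : Set Kg}
  {ν : Measure Kg} [ν.IsHaarMeasure] {μ : Measure X} [IsFiniteMeasure μ]
  {κ : Measure Z} [SFinite κ] [IsFiniteMeasureOnCompacts κ]

omit [MeasurableSpace Vt] [BorelSpace Vt] [NormedSpace ℝ Z] [FiniteDimensional ℝ Z] [BorelSpace Z] [CompactSpace X] [SecondCountableTopology X]
  [MeasurableSpace X] [BorelSpace X] [SFinite κ] [IsFiniteMeasureOnCompacts κ] in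
/-- ★ **THE ORBIT CONSTANT IS POSITIVE**: in the structural setting (`0 < ν(((e ball ρ)·Sst)⁻¹) < ∞` by `measure_windowConst_ne_zero_of_chart`, `det Ah > 0` by
`det_pos_of_inner_pos`), a positive amplitude at the minimiser and a positive window integral of the chart density make the limit constant positive —
the `0 < C x` input of the KNIT. [cite: Breitung1994, Thm 41 p. 56] [cite: Helgason2000, Ch. I §1 Thm 1.14 p. 96] -/
theorem orbitConst_pos
    (hact : Continuous fun p : Kg × X => act p.1 p.2)
    (hmul : ∀ k k' x, act (k * k') x = act k (act k' x)) (hone : ∀ x, act 1 x = x)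
    (hσ : Continuous σ) (he1 : e 0 = 1) (he𝓝 : 𝓝 (1 : Kg) ≤ map e (𝓝 0))
    (hΘ' : ∀ z y, Θ' (z, y) = act (e z) (σ y)) (hΘ'𝓝 : 𝓝 (σ 0) ≤ map Θ' (𝓝 0))
    {W : Set (Z × Vt)} (hWo : IsOpen W) (hinj : InjOn Θ' W)
    {ρ : ℝ} (hρ : 0 < ρ) (hρW : closedBall (0 : Z) ρ ×ˢ {(0 : Vt)} ⊆ W)
    (hstab : ∀ k : Kg, act k (σ 0) = σ 0 → k ∈ Sst) (hfix : ∀ s ∈ Sst, ∀ y, act s (σ y) = σ y)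
    {Ah : Vt →ₗ[ℝ] Vt} (hAs : Ah.IsSymmetric) (hpos : ∀ y, y ≠ 0 → 0 < ⟪Ah y, y⟫_ℝ)
    {J : Z × Vt → ℝ} (hJ00 : 0 < ∫ z in ball (0 : Z) ρ, J (z, 0) ∂κ) {a0 : ℝ} (ha0 : 0 < a0) :
    0 < (2 * π) ^ ((finrank ℝ Vt : ℝ) / 2) * (ν.real univ *
        ((∫ z in ball (0 : Z) ρ, J (z, 0) ∂κ) / (ν (((e '' ball (0 : Z) ρ) * Sst)⁻¹)).toReal * a0 /
          Real.sqrt (LinearMap.det Ah))) := by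
  have hWn : W ∈ 𝓝 ((0 : Z), (0 : Vt)) := hWo.mem_nhds (hρW ⟨mem_closedBall_self hρ.le, rfl⟩)
  have hWn' : W ∈ 𝓝 (0 : Z × Vt) := by simpa only [Prod.zero_eq_mk] using hWn
  obtain ⟨hc0, hctop⟩ := measure_windowConst_ne_zero_of_chart (ν := ν) hact hmul hone hσ he1 he𝓝 hΘ' hΘ'𝓝 hWn' hinj hstab hfix
    (ball_mem_nhds (0 : Z) hρ)
  have hνK : 0 < ν.real univ := by
    rw [measureReal_def, ENNReal.toReal_pos_iff]
    exact ⟨pos_iff_ne_zero.mpr (IsOpenPosMeasure.open_pos univ isOpen_univ univ_nonempty), measure_lt_top ν _⟩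
  have hquot : 0 < ((∫ z in ball (0 : Z) ρ, J (z, 0) ∂κ) / (ν (((e '' ball (0 : Z) ρ) * Sst)⁻¹)).toReal) :=
    div_pos hJ00 (ENNReal.toReal_pos hc0 hctop)
  have hdet : 0 < Real.sqrt (LinearMap.det Ah) := Real.sqrt_pos.2 (det_pos_of_inner_pos hAs hpos)
  positivity

/-! ## §2 The LIMIT door at one window datum -/
/-- ★★ **LIMIT — THE PER-CORNER SCALED LAPLACE LIMIT AT A WINDOW DATUM, AS A DOOR** (LAPLACE row of LINE g18-1, letter LIMIT; (T) = CHART∞ ∘ LIMIT ∘ KNIT ∘ DECAY).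
Given a compact orbit-Laplace MODEL of `heightDensityCan F (γ∕λ) hJK S V · e^{λβ_K m}` (`hmodel`, plus the ★★★ theorem's structural rows for the residual-gauge
action, the transversal, the group chart, the window chart with continuous density and the slice), the EXW rows (`σ 0 ∈ O`, `A (σ 0) = m`) and the GAP♯ rows
(growth function `g`, non-degenerate transversal Hessian `Ah` with Peano expansion), then
`λ^{dim∕2} · (heightDensityCan F (γ∕λ) hJK S V · e^{λβ_K(γ) m}) ⟶ ℓ ∕ β_K(γ)^{dim∕2}` with the explicit orbit constant `ℓ` — the hypothesis `hU` of
✓`…S2BetaLaplaceKnit.tendsto_fourPt_fluct_of_laplaceLimits` at the corner `V`.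
[cite: Balaban1985UV3, (2) p. 256 and (41) p. 266] [cite: Balaban1985Variational, Thm 1 (8)-(10) p. 279 and (142) p. 299]
[cite: HasenpflugRudolfSprungk2024, §3.1 Assumption 3 (M)(T), §3.4 and App. 4.1 Thm 16] [cite: Hwang1980, main theorem] [cite: Breitung1994, Thm 41 p. 56] -/
theorem laplaceLimit_corner
    -- the S2β corner
    (F : T3Family) {γ : ℝ} (hγ : 0 < γ) {Jh Kh : ℕ} (hJK : Jh ≤ Kh)
    (S : Set (GaugeField (F.P Kh) 0 (Matrix.specialUnitaryGroup (Fin 2) ℂ))) (m : ℝ)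
    (V : GaugeField (F.P Jh) 0 (Matrix.specialUnitaryGroup (Fin 2) ℂ))
    -- MODEL: phase, amplitude, event on `X`, and the identity with the canonical density
    {A a : X → ℝ} {O : Set X}
    (hmodel : ∀ lam : ℝ, 0 < lam →
      heightDensityCan F (γ / lam) hJK S V * Real.exp (lam * (F.scheme ℰp γ).β Kh * m) =
        ∫ x, Real.exp (-(lam * (F.scheme ℰp γ).β Kh) * (A x - m)) * O.indicator a x ∂μ)
    -- MODEL: the residual-gauge action and the charts (letters of the ★★★ theorem)
    (hact : Continuous fun p : Kg × X => act p.1 p.2)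
    (hmul : ∀ k k' x, act (k * k') x = act k (act k' x)) (hone : ∀ x, act 1 x = x)
    (hpres : ∀ k, MeasurePreserving (act k) μ μ)
    (hσ : Continuous σ) (he : Continuous e) (he1 : e 0 = 1) (he𝓝 : 𝓝 (1 : Kg) ≤ map e (𝓝 0))
    (hΘ : ∀ k y, Θ (k, y) = act k (σ y)) (hΘ' : ∀ z y, Θ' (z, y) = act (e z) (σ y))
    (hΘ'𝓝 : 𝓝 (σ 0) ≤ map Θ' (𝓝 0))
    {W : Set (Z × Vt)} (hWo : IsOpen W) (hinj : InjOn Θ' W)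
    {J : Z × Vt → ℝ} (hJc : ContinuousOn J W) (hJ0 : ∀ w ∈ W, 0 ≤ J w)
    (hchart : μ.restrict (Θ' '' W) =
      (((κ.prod volume).restrict W).withDensity fun w => ENNReal.ofReal (J w)).map Θ')
    {ρ : ℝ} (hρ : 0 < ρ) (hρW : closedBall (0 : Z) ρ ×ˢ {(0 : Vt)} ⊆ W)
    (hstab : ∀ k : Kg, act k (σ 0) = σ 0 → k ∈ Sst) (hfix : ∀ s ∈ Sst, ∀ y, act s (σ y) = σ y)
    (hA : Continuous A) (ha : Continuous a)
    (hAinv : ∀ k x, A (act k x) = A x) (hainv : ∀ k x, a (act k x) = a x)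
    (hO : IsOpen O) (hOinv : ∀ k x, x ∈ O → act k x ∈ O)
    -- EXW: the minimiser is the base point of the transversal, inside the event, with action `m`
    (hO0 : σ 0 ∈ O) (hmin : A (σ 0) = m)
    -- GAP♯: growth to the residual orbit on the event, and the non-degenerate transversal Hessian
    {g : X → ℝ} (hg : Continuous g) (hg0 : ∀ x, 0 ≤ g x) (hgpos : ∀ x, (∀ k, act k (σ 0) ≠ x) → 0 < g x)
    (hgrow : ∀ x ∈ O, m + g x ≤ A x)
    {Ah : Vt →ₗ[ℝ] Vt} (hAs : Ah.IsSymmetric) (hpos : ∀ y, y ≠ 0 → 0 < ⟪Ah y, y⟫_ℝ)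
    (hS2 : (fun y => A (σ y) - A (σ 0) - (1 / 2) * ⟪Ah y, y⟫_ℝ) =o[𝓝 0] fun y => ‖y‖ ^ 2) :
    Tendsto (fun lam : ℝ => lam ^ ((finrank ℝ Vt : ℝ) / 2) *
        (heightDensityCan F (γ / lam) hJK S V * Real.exp (lam * (F.scheme ℰp γ).β Kh * m))) atTop
      (𝓝 (((2 * π) ^ ((finrank ℝ Vt : ℝ) / 2) * (ν.real univ *
          ((∫ z in ball (0 : Z) ρ, J (z, 0) ∂κ) / (ν (((e '' ball (0 : Z) ρ) * Sst)⁻¹)).toReal * a (σ 0) /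
            Real.sqrt (LinearMap.det Ah)))) / ((F.scheme ℰp γ).β Kh) ^ ((finrank ℝ Vt : ℝ) / 2))) := by
  -- Laplace's method in the library's parameter `b`
  have hlap := tendsto_laplaceMethod_orbit_openSet_of_growth (ν := ν) (κ := κ) hact hmul hone hpres hσ he he1 he𝓝 hΘ hΘ' hΘ'𝓝
    hWo hinj hJc hJ0 hchart hρ hρW hstab hfix hA ha hAinv hainv hAs hpos hS2 hO hOinv hO0 hg hg0 hgpos
    (fun x hx => by rw [hmin]; exact hgrow x hx)
  rw [hmin] at hlap
  -- reparametrise `b = λ · β_K(γ)` and read the integral as the canonical density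
  refine (tendsto_rpow_mul_comp_mul_atTop (scheme_β_pos F hγ Kh) hlap).congr' ?_
  filter_upwards [eventually_gt_atTop (0 : ℝ)] with lam hlam
  rw [hmodel lam hlam]

omit [MeasurableSpace Vt] [BorelSpace Vt] [NormedSpace ℝ Z] [FiniteDimensional ℝ Z] [BorelSpace Z] [CompactSpace X] [SecondCountableTopology X]
  [MeasurableSpace X] [BorelSpace X] [SFinite κ] [IsFiniteMeasureOnCompacts κ] in
/-- ★ **… AND ITS LIMIT IS POSITIVE** (the `0 < C x` input of the KNIT at the corner `V`): under the slice ∕ chart rows, `0 < a (σ 0)` and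
`0 < ∫_{ball ρ} J(z,0) dκ`. [cite: Breitung1994, Thm 41 p. 56] [cite: Balaban1985UV3, (2) p. 256] -/
theorem laplaceLimit_corner_pos
    (F : T3Family) {γ : ℝ} (hγ : 0 < γ) (Kh : ℕ)
    (hact : Continuous fun p : Kg × X => act p.1 p.2)
    (hmul : ∀ k k' x, act (k * k') x = act k (act k' x)) (hone : ∀ x, act 1 x = x)
    (hσ : Continuous σ) (he1 : e 0 = 1) (he𝓝 : 𝓝 (1 : Kg) ≤ map e (𝓝 0))
    (hΘ' : ∀ z y, Θ' (z, y) = act (e z) (σ y)) (hΘ'𝓝 : 𝓝 (σ 0) ≤ map Θ' (𝓝 0))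
    {W : Set (Z × Vt)} (hWo : IsOpen W) (hinj : InjOn Θ' W)
    {ρ : ℝ} (hρ : 0 < ρ) (hρW : closedBall (0 : Z) ρ ×ˢ {(0 : Vt)} ⊆ W)
    (hstab : ∀ k : Kg, act k (σ 0) = σ 0 → k ∈ Sst) (hfix : ∀ s ∈ Sst, ∀ y, act s (σ y) = σ y)
    {Ah : Vt →ₗ[ℝ] Vt} (hAs : Ah.IsSymmetric) (hpos : ∀ y, y ≠ 0 → 0 < ⟪Ah y, y⟫_ℝ)
    {J : Z × Vt → ℝ} (hJ00 : 0 < ∫ z in ball (0 : Z) ρ, J (z, 0) ∂κ) {a : X → ℝ} (ha0 : 0 < a (σ 0)) :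
    0 < ((2 * π) ^ ((finrank ℝ Vt : ℝ) / 2) * (ν.real univ *
          ((∫ z in ball (0 : Z) ρ, J (z, 0) ∂κ) / (ν (((e '' ball (0 : Z) ρ) * Sst)⁻¹)).toReal * a (σ 0) /
            Real.sqrt (LinearMap.det Ah)))) / ((F.scheme ℰp γ).β Kh) ^ ((finrank ℝ Vt : ℝ) / 2) :=
  div_pos (orbitConst_pos (ν := ν) (κ := κ) hact hmul hone hσ he1 he𝓝 hΘ' hΘ'𝓝 hWo hinj hρ hρW hstab hfix hAs hpos hJ00 ha0)
    (Real.rpow_pos_of_pos (scheme_β_pos F hγ Kh) _)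

end Corner

/-! ## §3 GAP♯ along a transversal ⇒ the Hessian row `hpos` (for the seam's «Peano row») -/

section Hessian
variable {Vt : Type*} [NormedAddCommGroup Vt] [InnerProductSpace ℝ Vt]

/-- **QUADRATIC GROWTH ALONG THE TRANSVERSAL + PEANO EXPANSION ⇒ POSITIVE-DEFINITE HESSIAN**: if `φ y − φ 0 ≥ c‖y‖²` near `0` (`c > 0`; GAP♯ read along the
transversal `σ`, with a transversality constant) and `φ y − φ 0 − ½⟪A y, y⟫ = o(‖y‖²)`, then `⟪A y, y⟫ > 0` for `y ≠ 0` (indeed `≥ 2c‖y‖²`) — the row `hpos` of the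
door from the stiffness organ. [cite: Balaban1985Variational, (142) p. 299] [cite: Breitung1994, Lemma 40 p. 55] -/
theorem inner_pos_of_quadratic_growth {φ : Vt → ℝ} {Ah : Vt →ₗ[ℝ] Vt} {c : ℝ} (hc : 0 < c)
    (hgrow : ∀ᶠ y in 𝓝 (0 : Vt), c * ‖y‖ ^ 2 ≤ φ y - φ 0)
    (hS2 : (fun y => φ y - φ 0 - (1 / 2) * ⟪Ah y, y⟫_ℝ) =o[𝓝 0] fun y => ‖y‖ ^ 2) :
    ∀ y, y ≠ 0 → 0 < ⟪Ah y, y⟫_ℝ := by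
  intro y hy
  have hε : (0 : ℝ) < c / 2 := by positivity
  obtain ⟨δ, hδ, hball⟩ := Metric.eventually_nhds_iff.1 ((hS2.def hε).and hgrow)
  have hypos : 0 < ‖y‖ := norm_pos_iff.2 hy
  set t : ℝ := δ / (2 * ‖y‖) with ht
  have htpos : 0 < t := by positivity
  have hty : ‖t • y‖ = δ / 2 := by
    rw [norm_smul, Real.norm_of_nonneg htpos.le, ht]
    field_simp
  have hz : dist (t • y) 0 < δ := by
    rw [dist_zero_right, hty]
    linarith
  obtain ⟨hA, hG⟩ := hball hz
  have hA' : |φ (t • y) - φ 0 - 1 / 2 * ⟪Ah (t • y), t • y⟫_ℝ| ≤ c / 2 * ‖t • y‖ ^ 2 := by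
    simpa only [Real.norm_eq_abs, abs_pow, abs_norm] using hA
  have hinner : ⟪Ah (t • y), t • y⟫_ℝ = t ^ 2 * ⟪Ah y, y⟫_ℝ := by
    rw [map_smul, real_inner_smul_left, real_inner_smul_right]
    ring
  have hn : ‖t • y‖ ^ 2 = t ^ 2 * ‖y‖ ^ 2 := by
    rw [norm_smul, Real.norm_of_nonneg htpos.le]
    ring
  have hup := (abs_le.1 hA').2
  rw [hinner, hn] at hup
  rw [hn] at hG
  by_contra hneg
  push Not at hneg
  have ht2 : 0 < t ^ 2 := by positivity
  have h3 : 1 / 2 * (t ^ 2 * ⟪Ah y, y⟫_ℝ) ≤ 0 := by nlinarith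
  have h4 : 0 < c / 2 * (t ^ 2 * ‖y‖ ^ 2) := by positivity
  nlinarith

/-- **THE QUANTITATIVE EDITION** (DECAY-grade; px11 g9's point): under the same hypotheses (any real `c`) the Hessian is UNIFORMLY coercive,
`2c‖y‖² ≤ ⟪Ah y, y⟫` for every `y` — a datum-uniform lower bound when `c` comes from GAP♯'s uniform `μ`, hence a uniform bound on `det Ah` from below and on
the Combes–Thomas gap across the corners of a quadrilateral. [cite: Balaban1985Variational, (142) p. 299] [cite: Breitung1994, Lemma 40 p. 55] -/
theorem inner_ge_of_quadratic_growth {φ : Vt → ℝ} {Ah : Vt →ₗ[ℝ] Vt} {c : ℝ}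
    (hgrow : ∀ᶠ y in 𝓝 (0 : Vt), c * ‖y‖ ^ 2 ≤ φ y - φ 0)
    (hS2 : (fun y => φ y - φ 0 - (1 / 2) * ⟪Ah y, y⟫_ℝ) =o[𝓝 0] fun y => ‖y‖ ^ 2) (y : Vt) :
    2 * c * ‖y‖ ^ 2 ≤ ⟪Ah y, y⟫_ℝ := by
  by_cases hy : y = 0
  · simp [hy]
  have hypos : 0 < ‖y‖ := norm_pos_iff.2 hy
  -- for every `ε > 0`: `(c − ε)‖y‖² ≤ ½⟪Ah y, y⟫`
  refine le_of_forall_pos_lt_add fun ε hε => ?_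
  have hε' : (0 : ℝ) < ε / (4 * ‖y‖ ^ 2) := by positivity
  obtain ⟨δ, hδ, hball⟩ := Metric.eventually_nhds_iff.1 ((hS2.def hε').and hgrow)
  set t : ℝ := δ / (2 * ‖y‖) with ht
  have htpos : 0 < t := by positivity
  have hty : ‖t • y‖ = δ / 2 := by
    rw [norm_smul, Real.norm_of_nonneg htpos.le, ht]
    field_simp
  have hz : dist (t • y) 0 < δ := by
    rw [dist_zero_right, hty]
    linarith
  obtain ⟨hA, hG⟩ := hball hz
  have hA' : |φ (t • y) - φ 0 - 1 / 2 * ⟪Ah (t • y), t • y⟫_ℝ| ≤ ε / (4 * ‖y‖ ^ 2) * ‖t • y‖ ^ 2 := by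
    simpa only [Real.norm_eq_abs, abs_pow, abs_norm] using hA
  have hinner : ⟪Ah (t • y), t • y⟫_ℝ = t ^ 2 * ⟪Ah y, y⟫_ℝ := by
    rw [map_smul, real_inner_smul_left, real_inner_smul_right]
    ring
  have hn : ‖t • y‖ ^ 2 = t ^ 2 * ‖y‖ ^ 2 := by
    rw [norm_smul, Real.norm_of_nonneg htpos.le]
    ring
  have hup := (abs_le.1 hA').2
  rw [hinner, hn] at hup
  rw [hn] at hG
  have ht2 : 0 < t ^ 2 := by positivity
  -- `c t²‖y‖² ≤ ½ t² ⟪Ah y,y⟫ + (ε∕(2‖y‖²)) t² ‖y‖²`, divide by `t²`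
  have key : c * ‖y‖ ^ 2 ≤ 1 / 2 * ⟪Ah y, y⟫_ℝ + ε / (4 * ‖y‖ ^ 2) * ‖y‖ ^ 2 := by
    have h1 : t ^ 2 * (c * ‖y‖ ^ 2) ≤ t ^ 2 * (1 / 2 * ⟪Ah y, y⟫_ℝ + ε / (4 * ‖y‖ ^ 2) * ‖y‖ ^ 2) := by nlinarith
    exact le_of_mul_le_mul_left h1 ht2
  have hsimp : ε / (4 * ‖y‖ ^ 2) * ‖y‖ ^ 2 = ε / 4 := by
    field_simp
  rw [hsimp] at key
  linarith

end Hessian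

end Summit.QuantumFields.YangMills.Theorems.FluctuationComparisonRegPrIntLS2BetaLaplaceLimit

end
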